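import Summits.CriticalPhenomena.Ising3DConformalLimit.Theorems.PrecisionLaplacianDirectCorrelationStableTailSlabModeExpDecayAxisLineHolAux
import Summits.CriticalPhenomena.Ising3DConformalLimit.Theorems.PrecisionLaplacianDirectCorrelationStableTailSlabModeExpDecayAxisLineHolAux2
import Summits.CriticalPhenomena.Ising3DConformalLimit.Theorems.PrecisionLaplacianDirectCorrelationStableTailSlabSpectralRepresentation

/-!
# Brick `stub_slabModeExpDecay_auxAxisLineHol` of stub `stub_slabModeExpDecay` (line
# `self-energy-pick-inversion`, crux `PrecisionLaplacian.DirectCorrelationStableTail`, stmt-CriticalPhenomena-4799):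
# LINE HOLOMORPHY of the Green symbol function along the three axis frames

**Statement** (registered sub-stub `stub_slabModeExpDecay_auxAxisLineHol`; the axis disjunct of the
wave-3 interface `lineHolomorphy`). Let `G = criticalTwoPoint 3` satisfy `H` (every kernel matrix
`M_A = (G(q - p))_{p,q ∈ A}` is a symmetric potential), let `a = dcf` be its direct correlation function,
`A₀` the limit of `(M_{Λ_n})⁻¹(0,0)` along the centred boxes (threaded through its defining properties),
`q = 𝟙_{≠0} a/A₀` the step law of the walk dictionary and `g(p) = (1 - ∑ₓ q(x) cos(p·x))⁻¹` the GREEN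
SYMBOL FUNCTION on `ℝ³`. Then with the universal constant `c₀ = 1/2`: for all `d, m > 0` there is `B`
such that for every axis `u = eᵢ` and every base point `p ∈ ℝ³` with `dist(pᵢ, 2πℤ) ≥ d` whose axis
line `{p + t eᵢ}` stays at sup-distance `≥ m` from `(2πℤ)³`, the line function `s ↦ g(p + s eᵢ)`
extends to a holomorphic function `F` on the disc `|z| < d/2` with `|F| ≤ B` there.

**Proof.** Along the line, `θ ↦ g(ins_i(θ, k))` (`k` = the two transverse coordinates of `p`,
`k ∉ (2πℤ)²` by the margin hypothesis) is continuous, even, `2π`-periodic and positive, and its cosine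
moments form a Hausdorff moment sequence — at good momenta by `slabMoments_of_openCube` (reflection
positivity through the landed `stub_slabSpectralRepresentation`, Pick machinery of `stub_pickInversion`),
at every `k ∉ (2πℤ)²` by periodicity, continuity and weak compactness (file `…AxisLineHolAux2`). Hence
the Poisson representation `2π g(ins_i(θ, k)) = ∫ P_t(θ) dμ_k(t)` (`two_pi_mul_eq_integral_poisson`),
and `F(z) = (2π)⁻¹ ∫ (1 - t²)/(1 - 2t cos(pᵢ + z) + t²) dμ_k(t)` is the extension: the kernel is
holomorphic in the complex angle off `{Re ∈ 2πℤ}` and bounded by `1/sin²(d/2)` for `|z| < d/2`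
(file `…AxisLineHolAux`), while the mass `μ_k(ℝ) = ∫_{-π}^{π} g ≤ 2π/η(m)` is controlled by the uniform
symbol gap `1 - φ ≥ η(m)` at sup-distance `≥ m` from the reciprocal lattice (`exists_symbol_gap_of_margin`).
So `B = η(m)⁻¹/ sin²(d/2)`. No spectral gap enters: the singular set of the Poisson kernel does not depend
on the measure. References: Aizenman–Duminil-Copin (2021), Prop. 8.6; folklore (Poisson kernel, Herglotz).
-/

noncomputable section

namespace Summit.CriticalPhenomena.Ising3DConformalLimit.Cruxes.DirectCorrelationStableTail.SelfEnergyPickInversion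

open MeasureTheory Filter Topology Finset Real Literature.Probability.LatticeModels
open scoped BigOperators
open Summit.CriticalPhenomena.Ising3DConformalLimit.Theorems.EtaBoundsTransfer
  (limit_equation summable_a a_nonneg a_neg continuous_phase continuous_fourier_q)

/-! ### Geometry of the axis frames -/

/-- The dual step of the axis frame `eᵢ` is `eᵢ`: `∑ₗ (eᵢ)ₗ² = 1`. [folklore] -/
theorem sum_sq_single_one (i : Fin 3) : ∑ l, (((Pi.single i (1 : ℤ) : Site 3) l : ℤ) : ℝ) ^ 2 = 1 := by
  rw [Fin.sum_univ_succAbove _ i]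
  simp [Fin.succAbove_ne]

/-- `p·eᵢ = pᵢ`. [folklore] -/
theorem sum_mul_single_one (i : Fin 3) (p : Fin 3 → ℝ) :
    ∑ j, p j * (((Pi.single i (1 : ℤ) : Site 3) j : ℤ) : ℝ) = p i := by
  rw [Fin.sum_univ_succAbove _ i]
  simp [Fin.succAbove_ne]

/-- The axis line through `p` in the direction `eᵢ`: `p + t eᵢ = ins_i(pᵢ + t, k)` with `k` the
transverse coordinates of `p`. [folklore] -/
theorem axisLine_apply (i : Fin 3) (p : Fin 3 → ℝ) (t : ℝ) (j : Fin 3) :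
    p j + t * ((((Pi.single i (1 : ℤ) : Site 3) j : ℤ) : ℝ) /
      ∑ l, (((Pi.single i (1 : ℤ) : Site 3) l : ℤ) : ℝ) ^ 2) =
      (Fin.insertNth i (p i + t) (fun j' => p (i.succAbove j')) : Fin 3 → ℝ) j := by
  rw [sum_sq_single_one]
  rcases Fin.eq_self_or_eq_succAbove i j with rfl | ⟨j', rfl⟩
  · simp [Fin.insertNth_apply_same]
  · simp [Fin.insertNth_apply_succAbove, Fin.succAbove_ne]

/-! ### The brick -/

/-- **Registered sub-stub `stub_slabModeExpDecay_auxAxisLineHol`** (brick of `stub_slabModeExpDecay`; the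
axis disjunct `u = eᵢ` of the wave-3 line-holomorphy interface, everything else IDENTICAL to the interface
text): along every axis line at distance `≥ d` (in the line variable) and sup-distance `≥ m` from the
reciprocal lattice, the Green symbol function `g = (1 - ∑ₓ q(x) cos(p·x))⁻¹`, `q = 𝟙_{≠0} dcf/A₀`,
extends holomorphically to the disc of radius `d/2` with a bound depending on `(d, m)` only. See the
module docstring. [folklore] -/
theorem stub_slabModeExpDecay_auxAxisLineHol :
    (∀ A : Finset (Site 3), (Matrix.of fun (p q : ↥A) => criticalTwoPoint 3 (q.1 - p.1)).PosDef ∧ ∀ u v :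
      ↥A, (u ≠ v → (Matrix.of fun (p q : ↥A) => criticalTwoPoint 3 (q.1 - p.1))⁻¹ u v ≤ 0) ∧ 0 ≤ ∑ w,
      (Matrix.of fun (p q : ↥A) => criticalTwoPoint 3 (q.1 - p.1))⁻¹ u w) →
    ∀ A₀ : ℝ, Filter.Tendsto (fun n : ℕ => (Matrix.of fun (p q : ↥(box 3 n)) => criticalTwoPoint 3 (q.1 - p.1))⁻¹
        ⟨0, zero_mem_box 3 n⟩ ⟨0, zero_mem_box 3 n⟩) Filter.atTop (nhds A₀) →
      (∀ n : ℕ, (Matrix.of fun (p q : ↥(box 3 n)) => criticalTwoPoint 3 (q.1 - p.1))⁻¹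
        ⟨0, zero_mem_box 3 n⟩ ⟨0, zero_mem_box 3 n⟩ ≤ A₀) → 0 < A₀ →
    ∃ c₀ : ℝ, 0 < c₀ ∧ ∀ (d m : ℝ), 0 < d → 0 < m → ∃ B : ℝ,
      ∀ u : Site 3, (∃ i : Fin 3, u = Pi.single i 1) →
      ∀ p : Fin 3 → ℝ, (∀ n : ℤ, d ≤ |(∑ j, p j * (u j : ℝ)) - 2 * Real.pi * n|) →
        (∀ (t : ℝ) (L : Fin 3 → ℤ), m ≤ ‖(fun j => p j + t * ((u j : ℝ) / ∑ l, ((u l : ℝ)) ^ 2)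
          - 2 * Real.pi * (L j : ℝ))‖) →
        ∃ F : ℂ → ℂ, DifferentiableOn ℂ F (Metric.ball (0 : ℂ) (c₀ * d)) ∧
          (∀ s : ℝ, |s| < c₀ * d →
            F (s : ℂ) = (((1 - ∑' x : Site 3, (if x = 0 then (0 : ℝ) else
              (⨅ A : {A : Finset (Site 3) // (0 : Site 3) ∈ A ∧ x ∈ A}, -((Matrix.of fun (p q : ↥A.1) =>
                criticalTwoPoint 3 (q.1 - p.1))⁻¹ ⟨0, A.2.1⟩ ⟨x, A.2.2⟩))) / A₀ *
              Real.cos (∑ j, (p j + s * ((u j : ℝ) / ∑ l, ((u l : ℝ)) ^ 2)) * ((x j : ℤ) : ℝ)))⁻¹ : ℝ) : ℂ)) ∧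
          (∀ z : ℂ, ‖z‖ < c₀ * d → ‖F z‖ ≤ B) := by
  intro hH A₀ hkA hkle hA0
  classical
  have hπ := Real.pi_pos
  -- adapted from `stub_slabModeExpDecay_auxGreenTransfer` (file `…SlabModeExpDecayGreenTransfer`):
  -- the walk dictionary of `EtaBoundsTransfer` at the given `A₀`
  set M : (A : Finset (Site 3)) → Matrix ↥A ↥A ℝ :=
    fun A => Matrix.of fun (p q : ↥A) => criticalTwoPoint 3 (q.1 - p.1) with hMdef
  have hM : ∀ A, M A = Matrix.of fun (p q : ↥A) => criticalTwoPoint 3 (q.1 - p.1) := fun A => rfl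
  have hSP : ∀ A : Finset (Site 3), (M A).PosDef ∧
      ∀ u v : ↥A, (u ≠ v → (M A)⁻¹ u v ≤ 0) ∧ 0 ≤ ∑ w, (M A)⁻¹ u w := hH
  set kk : ℕ → ℝ := fun n => (M (box 3 n))⁻¹ ⟨0, zero_mem_box 3 n⟩ ⟨0, zero_mem_box 3 n⟩ with hkkdef
  have hk : ∀ n, kk n = (M (box 3 n))⁻¹ ⟨0, zero_mem_box 3 n⟩ ⟨0, zero_mem_box 3 n⟩ := fun n => rfl
  have hkA' : Tendsto kk atTop (𝓝 A₀) := hkA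
  have hkle' : ∀ n, kk n ≤ A₀ := hkle
  set tt : ℕ → Site 3 → ℝ := fun n y =>
    if hy : y ∈ box 3 n then -(M (box 3 n))⁻¹ ⟨0, zero_mem_box 3 n⟩ ⟨y, hy⟩ else 0 with httdef
  have ht : ∀ n y (hy : y ∈ box 3 n), tt n y = -(M (box 3 n))⁻¹ ⟨0, zero_mem_box 3 n⟩ ⟨y, hy⟩ :=
    fun n y hy => by simp only [httdef, dif_pos hy]
  set a : Site 3 → ℝ := fun y => ⨅ A : {A : Finset (Site 3) // (0 : Site 3) ∈ A ∧ y ∈ A},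
    -((M A.1)⁻¹ ⟨0, A.2.1⟩ ⟨y, A.2.2⟩) with hadef
  have ha : ∀ y, a y = ⨅ A : {A : Finset (Site 3) // (0 : Site 3) ∈ A ∧ y ∈ A},
      -((M A.1)⁻¹ ⟨0, A.2.1⟩ ⟨y, A.2.2⟩) := fun y => rfl
  have hGto : Tendsto (criticalTwoPoint 3) cofinite (𝓝 0) := criticalTwoPoint_tendsto_zero_cofinite
  have heq : ∀ z, A₀ * criticalTwoPoint 3 z - ∑' y, (if y = 0 then 0 else a y) * criticalTwoPoint 3 (z - y) =
      if z = 0 then 1 else 0 := fun z => limit_equation hM hSP hGto hk ht ha hkA' hkle' z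
  obtain ⟨hsa, hsale⟩ := summable_a hSP hk ht ha hkle'
  have ha0 : ∀ y, y ≠ 0 → 0 ≤ a y := fun y hy => a_nonneg hSP ha hy
  have haev : ∀ y, y ≠ 0 → a (-y) = a y := fun y hy => a_neg hM hSP ht ha hy
  have harefl : ∀ (i : Fin 3) (y : Site 3), y ≠ 0 → a (Function.update y i (-y i)) = a y :=
    fun i y hy => a_reflect hM hSP ht ha i (criticalTwoPoint_reflect i) hy
  -- the normalised step law `q = a'/A₀` and Green function `G' = A₀ G`
  set a' : Site 3 → ℝ := fun y => if y = 0 then 0 else a y with ha'def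
  set q : Site 3 → ℝ := fun y => a' y / A₀ with hqdef
  set G' : Site 3 → ℝ := fun z => A₀ * criticalTwoPoint 3 z with hG'def
  have ha'0 : ∀ y, 0 ≤ a' y := fun y => by
    simp only [ha'def]; split_ifs with hy
    · exact le_rfl
    · exact ha0 y hy
  have hq0 : ∀ y, 0 ≤ q y := fun y => div_nonneg (ha'0 y) hA0.le
  have hqs : Summable q := hsa.div_const A₀
  have hq1 : ∑' y, q y ≤ 1 := by
    simp only [hqdef]; rw [tsum_div_const]; exact (div_le_one hA0).2 hsale
  have hq00 : q 0 = 0 := by simp [hqdef, ha'def]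
  have hqev : ∀ y, q (-y) = q y := by
    intro y
    by_cases hy : y = 0
    · subst hy; simp
    · simp only [hqdef, ha'def, neg_eq_zero, if_neg hy, haev y hy]
  have hR0 : ∀ (i : Fin 3) (y : Site 3), Function.update y i (-y i) = 0 ↔ y = 0 := by
    intro i y
    constructor
    · intro h; ext j
      have hj := congrFun h j
      by_cases hji : j = i
      · subst hji; simpa using hj
      · rwa [Function.update_of_ne hji] at hj
    · rintro rfl; ext j; by_cases hji : j = i
      · subst hji; simp
      · simp [Function.update_of_ne hji]
  have hqrefl : ∀ (i : Fin 3) (y : Site 3), q (Function.update y i (-y i)) = q y := by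
    intro i y
    by_cases hy : y = 0
    · rw [hy, (hR0 i 0).2 rfl]
    · have hy' : Function.update y i (-y i) ≠ 0 := fun h => hy ((hR0 i y).1 h)
      simp only [hqdef, ha'def, if_neg hy, if_neg hy', harefl i y hy]
  have hG'0 : ∀ z, 0 ≤ G' z := fun z => mul_nonneg hA0.le (criticalTwoPoint_nonneg' z)
  have hG'C : ∀ z, G' z ≤ A₀ := fun z => by
    have := mul_le_mul_of_nonneg_left (criticalTwoPoint_le_one' (d := 3) z) hA0.le
    simpa [hG'def] using this
  have hG'to : Tendsto G' cofinite (𝓝 0) := by simpa [hG'def] using hGto.const_mul A₀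
  have hG'eq : ∀ z, G' z = (if z = 0 then 1 else 0) + ∑' y, q y * G' (z - y) := by
    intro z
    have h1 : ∑' y, q y * G' (z - y) = ∑' y, a' y * criticalTwoPoint 3 (z - y) :=
      tsum_congr fun y => by simp only [hqdef, hG'def]; field_simp
    rw [h1, ← heq z]; simp only [hG'def, ha'def]; ring
  -- convolution powers and the Green series
  set P : ℕ → Site 3 → ℝ := fun j => Nat.rec (fun z => if z = 0 then (1 : ℝ) else 0)
    (fun _ Pj z => ∑' y, q y * Pj (z - y)) j with hPdef
  have hP0 : ∀ z, P 0 z = if z = 0 then 1 else 0 := fun z => rfl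
  have hPs : ∀ j z, P (j + 1) z = ∑' y, q y * P j (z - y) := fun j z => rfl
  have hGreen : ∀ z, HasSum (fun j => P j z) (G' z) :=
    hasSum_convPow_of_green_equation hq0 hqs hq1 hq00 hP0 hPs hG'0 hG'C hG'to hG'eq
  have hGpos : ∀ m : Fin 3, 0 < G' (Pi.single m 1) := fun m => mul_pos hA0 (criticalTwoPoint_single_pos m)
  -- slab quadratic forms of `G'` (stub 1, landed)
  have hHS : ∀ (i : Fin 3) (s : Finset (Fin 2 → ℤ)) (v : (Fin 2 → ℤ) → ℝ), ∃ μ : Measure ℝ, IsFiniteMeasure μ ∧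
      μ (Set.Icc (0 : ℝ) 1)ᶜ = 0 ∧ ∀ n : ℕ,
        ∑ x ∈ s, ∑ y ∈ s, v x * v y * G' (Fin.insertNth i (n : ℤ) (x - y) : Site 3) = ∫ t, t ^ n ∂μ := by
    intro i s v
    obtain ⟨μ, hμfin, hμ0, hμmom⟩ := stub_slabSpectralRepresentation i s v
    refine ⟨A₀.toNNReal • μ, inferInstance, by rw [Measure.smul_apply, hμ0, smul_zero], fun n => ?_⟩
    rw [integral_smul_nnreal_measure, ← hμmom n, NNReal.smul_def, smul_eq_mul, Real.coe_toNNReal _ hA0.le,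
      Finset.mul_sum]
    refine Finset.sum_congr rfl fun x _ => ?_
    rw [Finset.mul_sum]
    refine Finset.sum_congr rfl fun y _ => ?_
    simp only [hG'def]; ring
  -- the symbol
  set φ : (Fin 3 → ℝ) → ℝ := fun ξ => ∑' x : Site 3, q x * Real.cos (phase 3 ξ x) with hφdef
  -- the constants: `c₀ = 1/2`, `B(d, m) = (2π)⁻¹ · (1 - cos²(d/2))⁻¹ · 2π/η(m)`
  refine ⟨1 / 2, one_half_pos, fun d m hd hm => ?_⟩
  obtain ⟨η, hη, hgap⟩ := exists_symbol_gap_of_margin hq0 hqs hq1 hP0 hPs hGreen hGpos hm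
  refine ⟨(2 * π)⁻¹ * (1 / (1 - Real.cos (d / 2) ^ 2) * (2 * π * η⁻¹)), fun u hu p hpd hpm => ?_⟩
  obtain ⟨i, rfl⟩ := hu
  -- the axis line `p + t eᵢ = ins_i(pᵢ + t, k)`
  set k : Fin 2 → ℝ := fun j' => p (i.succAbove j') with hkdef
  have hline : ∀ (t : ℝ) (j : Fin 3), p j + t * ((((Pi.single i (1 : ℤ) : Site 3) j : ℤ) : ℝ) /
      ∑ l, (((Pi.single i (1 : ℤ) : Site 3) l : ℤ) : ℝ) ^ 2) = (Fin.insertNth i (p i + t) k : Fin 3 → ℝ) j :=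
    fun t j => axisLine_apply i p t j
  have hpd' : ∀ n : ℤ, d ≤ |p i - 2 * π * n| := fun n => by
    have := hpd n; rwa [sum_mul_single_one] at this
  have hdπ : d ≤ π := le_pi_of_forall_le_abs_sub hpd'
  -- the slab circle through `p` stays at sup-distance `≥ m` from the reciprocal lattice
  have hmargin : ∀ (θ : ℝ) (L : Fin 3 → ℤ),
      m ≤ ‖(fun j => (Fin.insertNth i θ k : Fin 3 → ℝ) j - 2 * π * (L j : ℝ))‖ := by
    intro θ L
    have h := hpm (θ - p i) L
    have heq : (fun j => p j + (θ - p i) * ((((Pi.single i (1 : ℤ) : Site 3) j : ℤ) : ℝ) /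
        ∑ l, (((Pi.single i (1 : ℤ) : Site 3) l : ℤ) : ℝ) ^ 2) - 2 * π * (L j : ℝ)) =
        fun j => (Fin.insertNth i θ k : Fin 3 → ℝ) j - 2 * π * (L j : ℝ) := by
      funext j; rw [hline (θ - p i) j, show p i + (θ - p i) = θ by ring]
    rwa [heq] at h
  -- hence the transverse momentum `k` is off `(2πℤ)²`
  have hkoff : ∃ j, ∀ z : ℤ, k j ≠ z * (2 * π) := by
    obtain ⟨j, hj⟩ := exists_coord_not_mem_of_margin hm (hmargin 0)
    rcases Fin.eq_self_or_eq_succAbove i j with rfl | ⟨j', rfl⟩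
    · exact absurd (by simp [Fin.insertNth_apply_same]) (hj 0)
    · refine ⟨j', fun z hz => hj z ?_⟩
      rw [Fin.insertNth_apply_succAbove]; exact hz
  -- the Poisson representation on the line
  obtain ⟨hlt, hgcont, μ, hμfin, hμ0, hmass, hrepr⟩ := slab_two_pi_mul_inv_eq_integral_poisson hq0 hqs hq1
    hqev hP0 hPs hGreen hGpos i (hqrefl i) (hHS i) hkoff
  haveI := hμfin
  -- the mass bound `μ(ℝ) ≤ 2π/η`
  have hmassle : μ.real Set.univ ≤ 2 * π * η⁻¹ := by
    rw [hmass]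
    have hbound : ∀ θ : ℝ, (1 - φ (Fin.insertNth i θ k))⁻¹ ≤ η⁻¹ := fun θ =>
      (inv_le_inv₀ (lt_of_lt_of_le hη (hgap _ (hmargin θ))) hη).2 (hgap _ (hmargin θ))
    calc ∫ θ in (-π)..π, (1 - φ (Fin.insertNth i θ k))⁻¹ ≤ ∫ θ in (-π)..π, η⁻¹ :=
          intervalIntegral.integral_mono_on (by linarith) (hgcont.intervalIntegrable _ _)
            intervalIntegrable_const (fun θ _ => hbound θ)
      _ = 2 * π * η⁻¹ := by rw [intervalIntegral.integral_const, smul_eq_mul]; ring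
  -- the angular margin on the disc of radius `d/2`
  have hcd1 : Real.cos (d / 2) < 1 := by
    rw [← Real.cos_zero]
    exact Real.cos_lt_cos_of_nonneg_of_le_pi_div_two le_rfl (by linarith) (by linarith)
  have hcd0 : 0 ≤ Real.cos (d / 2) := Real.cos_nonneg_of_mem_Icc ⟨by linarith, by linarith⟩
  have hden : 0 < 1 - Real.cos (d / 2) ^ 2 := by nlinarith
  have hcosle : ∀ z : ℂ, ‖z‖ < 1 / 2 * d → Real.cos ((p i : ℂ) + z).re ≤ Real.cos (d / 2) := by
    intro z hz
    have hzre : |z.re| ≤ d - d / 2 := by have := Complex.abs_re_le_norm z; linarith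
    simp only [Complex.add_re, Complex.ofReal_re]
    exact cos_le_cos_of_forall_le_abs_sub (by linarith) (forall_le_abs_add_sub hpd' hzre)
  -- the holomorphic extension
  set PT : ℂ → ℂ := fun w => ∫ t, ((1 - t ^ 2 : ℝ) : ℂ) /
    (1 - 2 * (t : ℂ) * Complex.cos w + (t : ℂ) ^ 2) ∂μ with hPT
  refine ⟨fun z => (((2 * π)⁻¹ : ℝ) : ℂ) * PT ((p i : ℂ) + z), ?_, ?_, ?_⟩
  · -- holomorphy on the disc
    refine DifferentiableOn.const_mul ?_ _
    refine (differentiableOn_poissonTransform_cos μ hμ0).comp (by fun_prop) fun z hz => ?_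
    have hz' : ‖z‖ < 1 / 2 * d := by simpa using hz
    exact lt_of_le_of_lt (hcosle z hz') hcd1
  · -- values on the real segment
    intro s hs
    have hs' : ‖(s : ℂ)‖ < 1 / 2 * d := by rwa [Complex.norm_real, Real.norm_eq_abs]
    have hcos1 : Real.cos (p i + s) ≠ 1 := by
      have h := hcosle (s : ℂ) hs'
      simp only [Complex.add_re, Complex.ofReal_re] at h
      linarith
    have h1 : PT ((p i : ℂ) + (s : ℂ)) =
        ((∫ t, (1 - t ^ 2) / (1 - 2 * t * Real.cos (p i + s) + t ^ 2) ∂μ : ℝ) : ℂ) := by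
      rw [← Complex.ofReal_add]; exact poissonTransform_cos_ofReal μ (p i + s)
    have h2 := hrepr (p i + s) hcos1
    show (((2 * π)⁻¹ : ℝ) : ℂ) * PT ((p i : ℂ) + (s : ℂ)) = _
    rw [h1, ← h2, ← Complex.ofReal_mul, inv_mul_cancel_left₀ Real.two_pi_pos.ne']
    congr 1
    simp only [phase, hqdef, ha'def, hadef, hMdef, hline s]
  · -- the bound
    intro z hz
    rw [norm_mul, Complex.norm_real, Real.norm_eq_abs, abs_of_pos (by positivity)]
    have hb := norm_poissonTransform_cos_le μ hμ0 hcd0 hcd1 (hcosle z hz)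
    calc (2 * π)⁻¹ * ‖PT ((p i : ℂ) + z)‖ ≤ (2 * π)⁻¹ * (1 / (1 - Real.cos (d / 2) ^ 2) * μ.real Set.univ) := by
          gcongr
      _ ≤ (2 * π)⁻¹ * (1 / (1 - Real.cos (d / 2) ^ 2) * (2 * π * η⁻¹)) := by gcongr

end Summit.CriticalPhenomena.Ising3DConformalLimit.Cruxes.DirectCorrelationStableTail.SelfEnergyPickInversion

end
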